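import Mathlib
import HarnessLib
import Summits.AtomisticToContinuum.Crystallization.Theorems.PricedLinkCensusSoftFourRingsThreeTriQuad

/-!
# Fan coherence: the three triangles of a link fan are equally oriented

Route `PricedLinkCensus`, item `SoftFourRings` (stmt-AtomisticToContinuum-14234), evidence
`softrings-search.md` §10 (C1).  A site direction `v` whose four link-neighbour directions are bonded
along a path `w₀ ∼ w₁ ∼ w₂ ∼ w₃` (the three-triangle fan of `no_three_triangles_quad`, without the
bridging direction `x`): the path runs around `v` monotonically (the two dihedral cases of
`four_sorted_path_false`), so the three triangles `(v, w_k, w_{k+1})` have determinants of ONE sign —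
with respect to any basis of `ℝ³`.  This frame-free, order-free statement is the orientation datum
a rotation-system / planar-map layer needs, and step (C1) of the antiprism exclusion: along a ring of
fans sharing triangles the sign propagates, so the ring polygon turns consistently.

Contents: the circle lemma `four_sorted_path_orient` / `four_path_orient` (sign of the sines of the
three steps), tangent-frame coordinates `tangent_frame` and the frame determinant `frame_det`, the
sphere statement `fan_coherence` (general window constants) and its `η = 1/100` instance.
-/

namespace Summit.AtomisticToContinuum.Crystallization.Theorems

open Real RealInnerProductSpace

/-- **A short path runs around the circle one way (sorted form).**  `π/3 < g₀`, `2 g₀ ≤ π`,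
`0 ≤ g₁ < 2 g₀`; sorted angles `t₀ < ⋯ < t₃` in `(−π, π]`, pairwise `cos (t i − t j) ≤ cos g₀`; an
injective placement `q` of four labels with the label pairs `{0,1}, {1,2}, {2,3}` at circular
distance `≤ g₁`.  Then the three signed steps `t (q (k+1)) − t (q k)` all have positive sine or all
have negative sine. [folklore] -/
theorem four_sorted_path_orient {g₀ g₁ : ℝ} (hg₀ : π / 3 < g₀) (h2g₀ : 2 * g₀ ≤ π)
    (hg₁0 : 0 ≤ g₁) (hg₁₀ : g₁ < 2 * g₀) (t : Fin 4 → ℝ) (hmono : StrictMono t) (hlo : -π < t 0)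
    (hhi : t 3 ≤ π) (hsep : ∀ i j, i ≠ j → cos (t i - t j) ≤ cos g₀) (q : Fin 4 → Fin 4)
    (hq : Function.Injective q) (hb01 : cos g₁ ≤ cos (t (q 1) - t (q 0)))
    (hb12 : cos g₁ ≤ cos (t (q 2) - t (q 1))) (hb23 : cos g₁ ≤ cos (t (q 3) - t (q 2))) :
    (0 < sin (t (q 1) - t (q 0)) ∧ 0 < sin (t (q 2) - t (q 1)) ∧ 0 < sin (t (q 3) - t (q 2))) ∨
      (sin (t (q 1) - t (q 0)) < 0 ∧ sin (t (q 2) - t (q 1)) < 0 ∧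
        sin (t (q 3) - t (q 2)) < 0) := by
  have hπ := pi_pos
  obtain ⟨g1lo, g2lo, g3lo, g30hi, hd02, hd13⟩ := four_sorted_gaps hg₀ h2g₀ t hmono hlo hhi hsep
  -- diagonals are too long to be path steps
  have hcos2 : cos (2 * g₀) < cos g₁ := cos_lt_cos_of_nonneg_of_le_pi hg₁0 h2g₀ hg₁₀
  have nb02 : ¬ cos g₁ ≤ cos (t 2 - t 0) := fun h => by linarith
  have nb20 : ¬ cos g₁ ≤ cos (t 0 - t 2) := fun h => by rw [cos_sub_rev] at h; linarith
  have nb13 : ¬ cos g₁ ≤ cos (t 3 - t 1) := fun h => by linarith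
  have nb31 : ¬ cos g₁ ≤ cos (t 1 - t 3) := fun h => by rw [cos_sub_rev] at h; linarith
  have adj_of_bond : ∀ a b : Fin 4, a ≠ b → cos g₁ ≤ cos (t b - t a) →
      (b = a + 1 ∨ a = b + 1) := by
    intro a b hab h
    rcases fin_four_adj_or_diag a b hab with h' | ⟨rfl, rfl⟩ | ⟨rfl, rfl⟩ | ⟨rfl, rfl⟩ |
      ⟨rfl, rfl⟩
    · exact h'
    · exact absurd h nb02
    · exact absurd h nb20
    · exact absurd h nb13
    · exact absurd h nb31
  have c01 := adj_of_bond (q 0) (q 1) (hq.ne (by decide)) hb01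
  have c12 := adj_of_bond (q 1) (q 2) (hq.ne (by decide)) hb12
  have c23 := adj_of_bond (q 2) (q 3) (hq.ne (by decide)) hb23
  -- every cyclic step `t (a+1) - t a` has positive sine (it is a gap in `(0, π)`, up to `2π`)
  have h3g : π < (t 1 - t 0) + (t 2 - t 1) + (t 3 - t 2) := by linarith
  have hstep : ∀ a : Fin 4, 0 < sin (t (a + 1) - t a) := by
    intro a
    fin_cases a
    · exact sin_pos_of_pos_of_lt_pi (by simp; linarith) (by simp; linarith)
    · exact sin_pos_of_pos_of_lt_pi (by simp; linarith) (by simp; linarith)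
    · exact sin_pos_of_pos_of_lt_pi (by simp; linarith) (by simp; linarith)
    · have : sin (t 0 - t 3) = sin (t 0 - t 3 + 2 * π) := (sin_add_two_pi _).symm
      simp
      rw [this]
      exact sin_pos_of_pos_of_lt_pi (by linarith) (by linarith)
  have hstep' : ∀ a : Fin 4, sin (t a - t (a + 1)) < 0 := fun a => by
    rw [← neg_sub, sin_neg]; exact neg_neg_of_pos (hstep a)
  rcases fin_four_path_dihedral (q 0) (q 1) (q 2) (q 3) (hq.ne (by decide)) (hq.ne (by decide))
    c01 c12 c23 with ⟨h01, h12, h23, -⟩ | ⟨h10, h21, h32, -⟩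
  · left
    refine ⟨?_, ?_, ?_⟩
    · rw [h01]; exact hstep _
    · rw [h12]; exact hstep _
    · rw [h23]; exact hstep _
  · right
    refine ⟨?_, ?_, ?_⟩
    · rw [h10]; exact hstep' _
    · rw [h21]; exact hstep' _
    · rw [h32]; exact hstep' _

/-- **A short path runs around the circle one way.**  Four angles `θ k ∈ (−π, π]`, pairwise
separated (`cos (θ i − θ j) ≤ cos g₀`), with `cos g₁ ≤ cos (θ (k+1) − θ k)` for `k = 0, 1, 2`, where
`π/3 < g₀`, `2 g₀ ≤ π`, `0 ≤ g₁ < 2 g₀`: the sines of the three steps have a common strict sign.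
(Sort and apply `four_sorted_path_orient`.) [folklore] -/
theorem four_path_orient {g₀ g₁ : ℝ} (hg₀ : π / 3 < g₀) (h2g₀ : 2 * g₀ ≤ π) (hg₁0 : 0 ≤ g₁)
    (hg₁₀ : g₁ < 2 * g₀) (θ : Fin 4 → ℝ) (hθ : ∀ k, -π < θ k ∧ θ k ≤ π)
    (hsep : ∀ i j, i ≠ j → cos (θ i - θ j) ≤ cos g₀) (hb01 : cos g₁ ≤ cos (θ 1 - θ 0))
    (hb12 : cos g₁ ≤ cos (θ 2 - θ 1)) (hb23 : cos g₁ ≤ cos (θ 3 - θ 2)) :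
    (0 < sin (θ 1 - θ 0) ∧ 0 < sin (θ 2 - θ 1) ∧ 0 < sin (θ 3 - θ 2)) ∨
      (sin (θ 1 - θ 0) < 0 ∧ sin (θ 2 - θ 1) < 0 ∧ sin (θ 3 - θ 2) < 0) := by
  -- the angles are pairwise distinct
  have hcos1 : cos g₀ < 1 := by
    have := cos_lt_cos_of_nonneg_of_le_pi (le_refl 0) (by linarith) (by linarith : (0 : ℝ) < g₀)
    rwa [cos_zero] at this
  have hθinj : Function.Injective θ := by
    intro i j hij
    by_contra hne
    have := hsep i j hne
    rw [hij, sub_self, cos_zero] at this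
    linarith
  -- sort
  have hAcard : (Finset.univ.image θ).card = 4 := by
    rw [Finset.card_image_of_injective _ hθinj, Finset.card_univ, Fintype.card_fin]
  let e := (Finset.univ.image θ).orderEmbOfFin hAcard
  have hmem : ∀ i, ∃ k, e k = θ i := by
    intro i
    have hi : θ i ∈ Set.range e := by
      rw [Finset.range_orderEmbOfFin, Finset.coe_image]
      exact ⟨i, by simp, rfl⟩
    exact hi
  choose q hq using hmem
  have hqinj : Function.Injective q := by
    intro a b hab
    apply hθinj
    rw [← hq a, ← hq b, hab]
  have hmem' : ∀ k, ∃ i, θ i = e k := by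
    intro k
    have := (Finset.univ.image θ).orderEmbOfFin_mem hAcard k
    rw [Finset.mem_image] at this
    obtain ⟨i, -, hi⟩ := this
    exact ⟨i, hi⟩
  have key := four_sorted_path_orient hg₀ h2g₀ hg₁0 hg₁₀ (fun k => e k) e.strictMono ?_ ?_ ?_ q
    hqinj ?_ ?_ ?_
  · simp only [hq] at key
    exact key
  · show -π < e 0
    obtain ⟨i, hi⟩ := hmem' 0
    rw [← hi]; exact (hθ i).1
  · show e 3 ≤ π
    obtain ⟨i, hi⟩ := hmem' 3
    rw [← hi]; exact (hθ i).2
  · intro a b hab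
    obtain ⟨i, hi⟩ := hmem' a
    obtain ⟨j, hj⟩ := hmem' b
    have hne : i ≠ j := by
      rintro rfl
      exact hab (e.injective (hi.symm.trans hj))
    show cos (e a - e b) ≤ cos g₀
    rw [← hi, ← hj]
    exact hsep i j hne
  · show cos g₁ ≤ cos (e (q 1) - e (q 0))
    rw [hq, hq]; exact hb01
  · show cos g₁ ≤ cos (e (q 2) - e (q 1))
    rw [hq, hq]; exact hb12
  · show cos g₁ ≤ cos (e (q 3) - e (q 2))
    rw [hq, hq]; exact hb23

/-- **Tangent-frame coordinates.**  For an orthonormal basis `b` of `ℝ³` with `b 2 = v` and unit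
vectors `u i`: `⟪b 0, u i⟫ = ρ i cos θ i`, `⟪b 1, u i⟫ = ρ i sin θ i` with `ρ i ≥ 0`,
`ρ i ² = 1 − ⟪v, u i⟫²`, `θ i ∈ (−π, π]`. [folklore] -/
theorem tangent_frame {ι : Type*} {v : EuclideanSpace ℝ (Fin 3)}
    (b : OrthonormalBasis (Fin 3) ℝ (EuclideanSpace ℝ (Fin 3))) (hb : b 2 = v)
    (u : ι → EuclideanSpace ℝ (Fin 3)) (hu : ∀ i, ‖u i‖ = 1) :
    ∃ ρ θ : ι → ℝ, (∀ i, 0 ≤ ρ i) ∧ (∀ i, ρ i ^ 2 = 1 - ⟪v, u i⟫ ^ 2) ∧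
      (∀ i, -π < θ i ∧ θ i ≤ π) ∧ (∀ i, ⟪b 0, u i⟫ = ρ i * cos (θ i)) ∧
      ∀ i, ⟪b 1, u i⟫ = ρ i * sin (θ i) := by
  set X : ι → ℝ := fun k => ⟪b 0, u k⟫ with hXdef
  set Y : ι → ℝ := fun k => ⟪b 1, u k⟫ with hYdef
  have hZ : ∀ k, ⟪b 2, u k⟫ = ⟪v, u k⟫ := fun k => by rw [hb]
  have hXY : ∀ k, X k ^ 2 + Y k ^ 2 = 1 - ⟪v, u k⟫ ^ 2 := by
    intro k
    have h4 : ⟪u k, u k⟫ = 1 := by rw [real_inner_self_eq_norm_sq, hu k]; norm_num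
    rw [Literature.Geometry.DiscreteGeometry.inner_eq_sum_three b, hZ k] at h4
    simp only [hXdef, hYdef]
    nlinarith [h4]
  refine ⟨fun k => ‖(⟨X k, Y k⟩ : ℂ)‖, fun k => Complex.arg ⟨X k, Y k⟩, fun k => norm_nonneg _,
    fun k => ?_, fun k => ⟨Complex.neg_pi_lt_arg _, Complex.arg_le_pi _⟩,
    fun k => (polar_form (X k) (Y k)).1, fun k => (polar_form (X k) (Y k)).2.1⟩
  rw [← hXY k]; exact (polar_form (X k) (Y k)).2.2

/-- **The frame determinant.**  For an orthonormal basis `b` of `ℝ³` with `b 2 = v`: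
`det_b (v, x, y) = ⟪b 0, x⟫ ⟪b 1, y⟫ − ⟪b 0, y⟫ ⟪b 1, x⟫` (expansion along the coordinates of
`v = (0, 0, 1)`). [folklore] -/
theorem frame_det {v : EuclideanSpace ℝ (Fin 3)}
    (b : OrthonormalBasis (Fin 3) ℝ (EuclideanSpace ℝ (Fin 3))) (hb : b 2 = v)
    (x y : EuclideanSpace ℝ (Fin 3)) :
    b.toBasis.det ![v, x, y] = ⟪b 0, x⟫ * ⟪b 1, y⟫ - ⟪b 0, y⟫ * ⟪b 1, x⟫ := by
  have hon := orthonormal_iff_ite.mp b.orthonormal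
  have h0 : ⟪b 0, v⟫ = 0 := by rw [← hb, hon 0 2]; simp
  have h1 : ⟪b 1, v⟫ = 0 := by rw [← hb, hon 1 2]; simp
  have h2 : ⟪b 2, v⟫ = 1 := by rw [← hb, hon 2 2]; simp
  rw [Module.Basis.det_apply, Matrix.det_fin_three]
  simp only [Module.Basis.toMatrix_apply, OrthonormalBasis.coe_toBasis_repr_apply,
    OrthonormalBasis.repr_apply_apply, Matrix.cons_val_zero, Matrix.cons_val_one,
    Matrix.cons_val, h0, h1, h2]
  ring

/-- **Fan coherence** (unit-vector form, general constants).  Let `0 < cb ≤ ca < 1`, `ca² < cb`,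
`K (1 − ca²) = cb − ca²`, `K² ca² (1 − cb²) ≤ cb² (1 − ca²)`, `σ₁ = (ca − cb²)/(1 − ca²) < 1/2` and
`2σ₁² − 1 < K`.  If unit vectors `v, w₀, …, w₃` of `ℝ³` satisfy `cb ≤ ⟪v, w k⟫ ≤ ca`,
`⟪w i, w j⟫ ≤ ca` (`i ≠ j`) and `cb ≤ ⟪w₀, w₁⟫, ⟪w₁, w₂⟫, ⟪w₂, w₃⟫`, then for every basis `e` of
`ℝ³` the three determinants `det_e (v, w_k, w_{k+1})`, `k = 0, 1, 2`, are all positive or all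
negative. [folklore] -/
theorem fan_coherence {ca cb K : ℝ} (hcb0 : 0 < cb) (hcba : cb ≤ ca) (hca1 : ca < 1)
    (hsq : ca ^ 2 < cb) (hK : K * (1 - ca ^ 2) = cb - ca ^ 2)
    (hKs : K ^ 2 * ca ^ 2 * (1 - cb ^ 2) ≤ cb ^ 2 * (1 - ca ^ 2))
    (hσ : (ca - cb ^ 2) / (1 - ca ^ 2) < 1 / 2)
    (hσK : 2 * ((ca - cb ^ 2) / (1 - ca ^ 2)) ^ 2 - 1 < K)
    {v : EuclideanSpace ℝ (Fin 3)} (hv : ‖v‖ = 1) (w : Fin 4 → EuclideanSpace ℝ (Fin 3))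
    (hw : ∀ k, ‖w k‖ = 1) (hvw : ∀ k, cb ≤ ⟪v, w k⟫ ∧ ⟪v, w k⟫ ≤ ca)
    (hsep : ∀ i j, i ≠ j → ⟪w i, w j⟫ ≤ ca)
    (h01 : cb ≤ ⟪w 0, w 1⟫) (h12 : cb ≤ ⟪w 1, w 2⟫) (h23 : cb ≤ ⟪w 2, w 3⟫)
    (e : Module.Basis (Fin 3) ℝ (EuclideanSpace ℝ (Fin 3))) :
    (0 < e.det ![v, w 0, w 1] ∧ 0 < e.det ![v, w 1, w 2] ∧ 0 < e.det ![v, w 2, w 3]) ∨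
      (e.det ![v, w 0, w 1] < 0 ∧ e.det ![v, w 1, w 2] < 0 ∧ e.det ![v, w 2, w 3] < 0) := by
  set σ₁ := (ca - cb ^ 2) / (1 - ca ^ 2) with hσ₁
  have hca0 : 0 < ca := hcb0.trans_le hcba
  have h1ca : 0 < 1 - ca ^ 2 := by nlinarith
  have hσ0 : 0 ≤ σ₁ := div_nonneg (by nlinarith) h1ca.le
  have hK0 : 0 < K := by
    by_contra h
    have h' : K ≤ 0 := not_lt.mp h
    have := mul_le_mul_of_nonneg_right h' h1ca.le
    rw [hK, zero_mul] at this
    linarith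
  have hK1 : K ≤ 1 := by
    by_contra h
    have h' : 1 < K := not_le.mp h
    have := mul_lt_mul_of_pos_right h' h1ca
    rw [hK, one_mul] at this
    linarith
  -- tangent frame at `v`
  obtain ⟨b, hb⟩ := exists_orthonormalBasis_third_eq_unit hv
  obtain ⟨ρ, θ, hρ0, hρsq, hθ, hX, hY⟩ := tangent_frame b hb w hw
  have hcb_le : ∀ k, cb ≤ ⟪v, w k⟫ := fun k => (hvw k).1
  have hc_le : ∀ k, ⟪v, w k⟫ ≤ ca := fun k => (hvw k).2
  have hc0 : ∀ k, 0 ≤ ⟪v, w k⟫ := fun k => hcb0.le.trans (hcb_le k)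
  -- spherical law of cosines and the frame determinant in polar form
  have hinner : ∀ i j, ⟪w i, w j⟫ = ρ i * ρ j * cos (θ i - θ j) + ⟪v, w i⟫ * ⟪v, w j⟫ := by
    intro i j
    rw [Literature.Geometry.DiscreteGeometry.inner_eq_sum_three b, hb, hX, hX, hY, hY, cos_sub]
    ring
  have hdet : ∀ i j, b.toBasis.det ![v, w i, w j] = ρ i * ρ j * sin (θ j - θ i) := by
    intro i j
    rw [frame_det b hb, hX, hX, hY, hY, sin_sub]
    ring
  -- `ρ > 0`
  have hρpos : ∀ k, 0 < ρ k := by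
    intro k
    have : 0 < ρ k ^ 2 := by rw [hρsq]; nlinarith [hc_le k, hc0 k]
    exact lt_of_le_of_ne (hρ0 k) (fun h => by rw [← h] at this; simp at this)
  have hρρlo : ∀ i j, 1 - ca ^ 2 ≤ ρ i * ρ j := by
    intro i j
    have hi : 1 - ca ^ 2 ≤ ρ i ^ 2 := by rw [hρsq]; nlinarith [hc_le i, hc0 i]
    have hj : 1 - ca ^ 2 ≤ ρ j ^ 2 := by rw [hρsq]; nlinarith [hc_le j, hc0 j]
    have hsq2 : (1 - ca ^ 2) ^ 2 ≤ (ρ i * ρ j) ^ 2 := by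
      rw [mul_pow, sq (1 - ca ^ 2)]; exact mul_le_mul hi hj h1ca.le (sq_nonneg _)
    exact (pow_le_pow_iff_left₀ h1ca.le (mul_nonneg (hρ0 _) (hρ0 _)) two_ne_zero).1 hsq2
  -- separation (crude) and bonds (sharp) in the tangent circle
  have hsepθ : ∀ i j, i ≠ j → cos (θ i - θ j) ≤ σ₁ := by
    intro i j hij
    have h := hsep i j hij
    rw [hinner] at h
    have hcc : cb ^ 2 ≤ ⟪v, w i⟫ * ⟪v, w j⟫ := by nlinarith [hcb_le i, hcb_le j, hcb0]
    have hKK : ρ i * ρ j * cos (θ i - θ j) ≤ ca - cb ^ 2 := by linarith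
    rcases le_or_gt (cos (θ i - θ j)) 0 with hneg | hpos
    · exact hneg.trans hσ0
    · rw [hσ₁, le_div_iff₀ h1ca]
      calc cos (θ i - θ j) * (1 - ca ^ 2) ≤ cos (θ i - θ j) * (ρ i * ρ j) :=
            mul_le_mul_of_nonneg_left (hρρlo i j) hpos.le
        _ ≤ ca - cb ^ 2 := by linarith
  have hbondθ : ∀ i j, cb ≤ ⟪w i, w j⟫ → K ≤ cos (θ i - θ j) := by
    intro i j hbd
    rw [hinner, add_comm] at hbd
    exact corner_cos_lower hcb0 hca1 hsq hK hKs (hcb_le i) (hc_le i) (hc_le j) (hρ0 _) (hρsq i)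
      (hρ0 _) (hρsq j) hbd
  -- the angles
  set g₀ := arccos σ₁ with hg₀
  set g₁ := arccos K with hg₁
  have hσ1 : σ₁ ≤ 1 := by linarith
  have hcg₀ : cos g₀ = σ₁ := cos_arccos (by linarith) hσ1
  have hcg₁ : cos g₁ = K := cos_arccos (by linarith) hK1
  have hπ3 : π / 3 < g₀ := by
    have : arccos (1 / 2) = π / 3 :=
      arccos_eq_of_eq_cos (by positivity) (by linarith [pi_pos]) cos_pi_div_three.symm
    rw [hg₀, ← this]
    exact arccos_lt_arccos (by linarith) hσ (by norm_num)
  have h2g₀ : 2 * g₀ ≤ π := by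
    have := arccos_le_pi_div_two.2 hσ0
    rw [← hg₀] at this; linarith
  have hg₁0 : 0 ≤ g₁ := arccos_nonneg K
  have hg₁π : g₁ ≤ π := arccos_le_pi K
  have hg₁₀ : g₁ < 2 * g₀ := by
    by_contra h
    have h' : 2 * g₀ ≤ g₁ := not_lt.mp h
    have := cos_le_cos_of_nonneg_of_le_pi (by linarith [arccos_nonneg σ₁]) hg₁π h'
    rw [hcg₁, cos_two_mul, hcg₀] at this
    linarith
  have key := four_path_orient hπ3 h2g₀ hg₁0 hg₁₀ θ hθ (fun i j hij => by
      rw [hcg₀]; exact hsepθ i j hij)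
    (by rw [hcg₁, cos_sub_rev]; exact hbondθ 0 1 h01)
    (by rw [hcg₁, cos_sub_rev]; exact hbondθ 1 2 h12)
    (by rw [hcg₁, cos_sub_rev]; exact hbondθ 2 3 h23)
  -- signs in the frame `b`, then in the basis `e`
  have hframe : (0 < b.toBasis.det ![v, w 0, w 1] ∧ 0 < b.toBasis.det ![v, w 1, w 2] ∧
      0 < b.toBasis.det ![v, w 2, w 3]) ∨ (b.toBasis.det ![v, w 0, w 1] < 0 ∧
      b.toBasis.det ![v, w 1, w 2] < 0 ∧ b.toBasis.det ![v, w 2, w 3] < 0) := by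
    simp only [hdet]
    rcases key with ⟨s0, s1, s2⟩ | ⟨s0, s1, s2⟩
    · exact Or.inl ⟨mul_pos (mul_pos (hρpos 0) (hρpos 1)) s0,
        mul_pos (mul_pos (hρpos 1) (hρpos 2)) s1, mul_pos (mul_pos (hρpos 2) (hρpos 3)) s2⟩
    · exact Or.inr ⟨mul_neg_of_pos_of_neg (mul_pos (hρpos 0) (hρpos 1)) s0,
        mul_neg_of_pos_of_neg (mul_pos (hρpos 1) (hρpos 2)) s1,
        mul_neg_of_pos_of_neg (mul_pos (hρpos 2) (hρpos 3)) s2⟩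
  have hscale : ∀ u : Fin 3 → EuclideanSpace ℝ (Fin 3),
      e.det u = e.det b.toBasis * b.toBasis.det u := fun u => by
    conv_lhs => rw [AlternatingMap.eq_smul_basis_det b.toBasis e.det]
    rfl
  have hunit : e.det b.toBasis ≠ 0 := (e.isUnit_det b.toBasis).ne_zero
  rw [hscale ![v, w 0, w 1], hscale ![v, w 1, w 2], hscale ![v, w 2, w 3]]
  rcases lt_or_gt_of_ne hunit with hneg | hpos
  · rcases hframe with ⟨s0, s1, s2⟩ | ⟨s0, s1, s2⟩
    · exact Or.inr ⟨mul_neg_of_neg_of_pos hneg s0, mul_neg_of_neg_of_pos hneg s1,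
        mul_neg_of_neg_of_pos hneg s2⟩
    · exact Or.inl ⟨mul_pos_of_neg_of_neg hneg s0, mul_pos_of_neg_of_neg hneg s1,
        mul_pos_of_neg_of_neg hneg s2⟩
  · rcases hframe with ⟨s0, s1, s2⟩ | ⟨s0, s1, s2⟩
    · exact Or.inl ⟨mul_pos hpos s0, mul_pos hpos s1, mul_pos hpos s2⟩
    · exact Or.inr ⟨mul_neg_of_pos_of_neg hpos s0, mul_neg_of_pos_of_neg hpos s1,
        mul_neg_of_pos_of_neg hpos s2⟩

/-- **Fan coherence at `η = 1/100`**: with `ca = 1 − 1/(2·(101/100)²)`, `cb = 1 − (101/100)²/2`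
(the angular window of `softFourRings_of_twelve_unit`), the three triangles of a three-triangle fan
of the soft link are equally oriented. [folklore] -/
theorem fan_coherence_one_percent {v : EuclideanSpace ℝ (Fin 3)} (hv : ‖v‖ = 1)
    (w : Fin 4 → EuclideanSpace ℝ (Fin 3)) (hw : ∀ k, ‖w k‖ = 1)
    (hvw : ∀ k, (1 - (101 / 100 : ℝ) ^ 2 / 2) ≤ ⟪v, w k⟫ ∧
      ⟪v, w k⟫ ≤ 1 - 1 / (2 * (101 / 100 : ℝ) ^ 2))
    (hsep : ∀ i j, i ≠ j → ⟪w i, w j⟫ ≤ 1 - 1 / (2 * (101 / 100 : ℝ) ^ 2))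
    (h01 : (1 - (101 / 100 : ℝ) ^ 2 / 2) ≤ ⟪w 0, w 1⟫)
    (h12 : (1 - (101 / 100 : ℝ) ^ 2 / 2) ≤ ⟪w 1, w 2⟫)
    (h23 : (1 - (101 / 100 : ℝ) ^ 2 / 2) ≤ ⟪w 2, w 3⟫)
    (e : Module.Basis (Fin 3) ℝ (EuclideanSpace ℝ (Fin 3))) :
    (0 < e.det ![v, w 0, w 1] ∧ 0 < e.det ![v, w 1, w 2] ∧ 0 < e.det ![v, w 2, w 3]) ∨
      (e.det ![v, w 0, w 1] < 0 ∧ e.det ![v, w 1, w 2] < 0 ∧ e.det ![v, w 2, w 3] < 0) :=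
  fan_coherence (ca := 1 - 1 / (2 * (101 / 100 : ℝ) ^ 2)) (cb := 1 - (101 / 100 : ℝ) ^ 2 / 2)
    (K := 478679849399 / 1540200000000) (by norm_num) (by norm_num) (by norm_num) (by norm_num)
    (by norm_num) (by norm_num) (by norm_num) (by norm_num) hv w hw hvw hsep h01 h12 h23 e

end Summit.AtomisticToContinuum.Crystallization.Theorems
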